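import Summits.QuantumFields.BalabanUV.T4Continuum.Support.AveragingDeficitTwoLevelPrep

/-!
# AveragingDeficitTwoLevelFermat (T⁴ programme, node NE3, row NE3-R2, gen 3) — THE TWO-LEVEL INSTANCE OF R0: for
# Bałaban's COMPOSITE (two-step) averaging constraint `avg(avg U) = V_top` the abstract constraint `Q` of
# `AveragingDeficitFermat.fineCritical_of_isLocalMin` IS the second average in its exponential chart, so gen 2's
# R2ᴱ-torus holds for HONEST two-level constrained minimisers, with tangency `D avg(V̄)[φ] = 0` — the non-linear
# analogue of the linear-model theorem `T4AveragingDeficitTwoLevel.coarseResidual_twoLevel`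

HONEST FRAMING (cell `pub-balaban`, T4-DAG PAGE 1; unit `b2b-balaban-t4-ne3r2-p1` = owner of BINDER-OWNERS row NE3-R2,
gen 3).  The cell's T4 target is the finite-torus continuum limit of the unit-scale averaged loop expectations — NOT
infinite volume, NO mass gap, NOT Clay, NOT summit progress.  `AveragingDeficitFermat` proved R0 for a constraint
`Q(cavg L U) = Q(cavg L V)` with `Q` ABSTRACT (strictly differentiable in the coarse chart, differential onto from the
`𝔲(N)` directions).  B11 §E ((115)–(121), Prop. 6) compares the minimiser under the COMPOSITE constraint (two averaging
steps) with the one-step minimiser; THIS FILE instantiates `Q` for that case, all [folklore], 0 sorry: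
(§1–§3 = file 1/2 `AveragingDeficitTwoLevelPrep`: `skewSub`, `twoLevelQ`/`twoLevelQ'`, `twoLevelSmall`,
`smallField_cavg`, `cavg_isUnitaryCfg`, `cavg_cavg_eq_of_twoLevelQ_eq`); §4 **`fineCritical_twoLevel`** — R0 for HONEST
two-level constrained minimisers:
if the `U(N)`-valued `V` of period `L·(L·M′)` with `|V(∂p) − 1| ≤ a` minimises the fine Wilson action of the period among
the unitary periodic `U` with `|U(∂p) − 1| ≤ b` (`a < b`, `twoLevelSmall d L·b ≤ 1`) and THE SAME SECOND AVERAGE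
`cavg L (cavg L U) = cavg L (cavg L V)`, then `FineCritical L (L·M′) V (twoLevelQ' ∘ res = 0)`; and **`dualResidual_twoLevel`**
— gen 2's R2ᴱ-torus for such `V` against EVERY periodic coarse `𝔲(N)` direction `φ` TANGENT TO THE FIBRE OF THE SECOND
AVERAGE, `pushDir L (cavg L V) φ (L·z) = 0` (B11's `T = ker D Q̄(W_k)`): `L^{d−4}|⟨J(V̄), φ⟩| ≤ wallConst·[‖∇_VF‖_{ℓ²}·dualC2·
‖φ‖_{ℓ²} + a²·dualC1·‖φ‖_{ℓ¹}]`.  Inputs BY NAME: `fineCritical_of_isLocalMin`, `eventually_smallField_chart`,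
`eventually_cavg_chart_eq`, `contDiffAt_coord`/`fderiv_coord_apply` (file 2/3) one level up, gen 2's `exists_lift_periodic`
one level up (the submersion of the second average), `dualResidual_torus`.
WHAT THIS IS NOT: NE3 (ML — tangent coercivity —, (γ2)–(γ4) and the δ-dictionary remain, record `t4/T4-EST-NE3-P2.md`
§0 (e)); the `k`-step composite constraint for `k ≥ 3` is the same induction and is not written here; existence of the
minimiser (compactness) is not needed and not claimed.  NE3 stays COND-free.
CITATION HEADER: no printed sentence is a hypothesis; the manuscripts under audit are not cited for any disputed step;
context: T. Bałaban, Commun. Math. Phys. **98** (1985) 17–51 [Balaban1985Averaging] ((42) p. 23, (44) p. 24, Prop. 1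
p. 24); **102** (1985) 277–309 [Balaban1985Variational] (§E (115)–(121) p. 295, Prop. 6: minimisers of composite vs
one-step constraints).
PLACEMENT: `Summits/QuantumFields/BalabanUV/` (human rule 2026-08-19).  Record: HOME `t4/T4-EST-NE3-R2.md` v0.4.
-/

set_option autoImplicit false

open scoped BigOperators Matrix Matrix.Norms.L2Operator Topology
open NormedSpace Finset Filter

namespace Summit.QuantumFields.BalabanUV.T4Continuum.AveragingDeficitTwoLevelFermat

open Literature.MathematicalPhysics.QuantumFieldTheory.Balaban1983to89
open B7Prop1Explicit B7Prop2Explicit MatrixLog UnitaryModel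
open T4AveragingDeficitWall hiding Site Plane Plaq Bond
open T4AveragingDeficitWallBoundary (IsPeriodicCfg periodBox)
open T4AveragingDeficitNonAbelian (hol_add_period)
open AveragingDeficitTransport AveragingDeficitPlaqDeriv AveragingDeficitSideDeriv AveragingDeficitPeriodicCounting
open AveragingDeficitDerivWallProof AveragingDeficitResidualPairing AveragingDeficitFaceWords AveragingDeficitFaceLift
open AveragingDeficitLiftPeriodic
open AveragingDeficitDualResidual AveragingDeficitTorusChart AveragingDeficitChartCalculus AveragingDeficitFermat
open AveragingDeficitTwoLevelPrep

noncomputable section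

variable {d : ℕ} {n : Type*} [Fintype n] [DecidableEq n]

local notation "𝕄" => Matrix n n ℂ
local notation "Site" => B7Prop1Explicit.Site

/-! ## §4 R0 and R2ᴱ for honest two-level constrained minimisers -/

/-- **R0 FOR THE COMPOSITE (TWO-LEVEL) AVERAGING CONSTRAINT.**  Let `V` be `U(N)`-valued of period `L·(L·M′)` with
`|V(∂p) − 1| ≤ a`, `0 ≤ a < b`, `twoLevelSmall d L·b ≤ 1`.  If `V` minimises the fine Wilson action of the period
`[0, L·L·M′)^d` among the `U(N)`-valued `U` of the same period with `|U(∂p) − 1| ≤ b` and THE SAME SECOND AVERAGE,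
`cavg L (cavg L U) = cavg L (cavg L V)` (Bałaban's composite constraint `Q̄(Q̄(U)) = V_top`), then `V` is critical for the
fine action along every periodic face-supported `𝔲(N)` direction whose push-forward `φ` obeys `twoLevelQ'(res φ) = 0`,
i.e. is tangent to the fibre of the second average: `FineCritical L (L·M′) V (twoLevelQ' (cavg L V) ∘ res = 0)`.
Proof: `fineCritical_of_isLocalMin` with `Q := twoLevelQ L M′ (cavg L V)` — strictly differentiable in the coarse chart
by `contDiffAt_coord` ONE LEVEL UP (the average `cavg L V` is unitary and small-field with radius `prop1Radius a ≤ 2L²a`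
by B7 Prop. 1, tree `prop1_explicit`), differential onto `skewSub M′` by gen 2's `exists_lift_periodic` ONE LEVEL UP —
and the side condition `Near U := |U(∂p) − 1| ≤ b ∧` (second averages relatively within `1/4`), a chart neighbourhood by
`eventually_smallField_chart` and continuity through `eventually_cavg_chart_eq`, under which the chart constraint
decodes to the honest one (`cavg_cavg_eq_of_twoLevelQ_eq`). [cite: Balaban1985Variational, (115)–(121) p.295] -/
theorem fineCritical_twoLevel [Nonempty n] {L M' : ℕ} [NeZero L] [NeZero M'] {V : Site d → Fin d → 𝕄ˣ}
    (hV : IsUnitaryCfg V) (hVP : IsPeriodicCfg V ((L : ℤ) * (L * M' : ℕ))) {a b : ℝ} (ha : 0 ≤ a) (hab : a < b)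
    (hb : twoLevelSmall d L * b ≤ 1) (hVa : SmallField V a)
    (hmin : ∀ U : Site d → Fin d → 𝕄ˣ, IsUnitaryCfg U → IsPeriodicCfg U ((L : ℤ) * (L * M' : ℕ)) → SmallField U b →
      cavg L (cavg L U) = cavg L (cavg L V) →
        fineAction V (blockWindow L (periodBox (L * M'))).2 ≤ fineAction U (blockWindow L (periodBox (L * M'))).2) :
    FineCritical L (L * M') V (fun φ => twoLevelQ' L M' (cavg L V) (resDir (L * M') φ) = 0) := by
  have hL : 1 ≤ L := Nat.one_le_iff_ne_zero.mpr (NeZero.ne L)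
  have hb0 : 0 ≤ b := ha.trans hab.le
  have haS : twoLevelSmall d L * a ≤ 1 :=
    (mul_le_mul_of_nonneg_left hab.le (by unfold twoLevelSmall; positivity)).trans hb
  obtain ⟨hliftA, ha1, ha1le, hliftA1⟩ := smallness_of_twoLevelSmall (d := d) hL ha haS
  obtain ⟨hliftB, hb1, hb1le, hliftB1⟩ := smallness_of_twoLevelSmall (d := d) hL hb0 hb
  have h512a : 512 * (d + 1) * (d + 4) * (L : ℝ) ^ 2 * a ≤ 1 := small512_of_liftSmall hL ha hliftA
  have h512a1 : 512 * (d + 1) * (d + 4) * (L : ℝ) ^ 2 * prop1Radius d L a ≤ 1 := small512_of_liftSmall hL ha1 hliftA1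
  have h512b : 512 * (d + 1) * (d + 4) * (L : ℝ) ^ 2 * b ≤ 1 := small512_of_liftSmall hL hb0 hliftB
  have h512b1 : 512 * (d + 1) * (d + 4) * (L : ℝ) ^ 2 * prop1Radius d L b ≤ 1 := small512_of_liftSmall hL hb1 hliftB1
  -- the averaged configuration `V̄₁ = cavg L V` one level up: unitary, periodic, small-field
  have hV₁u : IsUnitaryCfg (cavg L V) := cavg_isUnitaryCfg hL hV ha h512a hVa
  have hV₁P : IsPeriodicCfg (cavg L V) ((L : ℤ) * M') := by
    have h := isPeriodicCfg_cavg L (L * M') hVP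
    rw [natCast_mul_period] at h
    exact h
  have hV₁a : SmallField (cavg L V) (prop1Radius d L a) := smallField_cavg hL hV ha h512a hVa
  have hW₁ : ∀ (q : Site d) (κ : Fin d) (r : Fin d → Fin L), ‖((Wcx L (cavg L V) q κ (boxVec L r) : 𝕄ˣ) : 𝕄) - 1‖ < 1 :=
    norm_Wcx_sub_one_lt_one_of_smallField L hL hV₁u ha1 h512a1 hV₁a
  haveI : CompleteSpace ↥(skewSub d n M') := FiniteDimensional.complete ℝ _
  -- strict differentiability of `Q` in the coarse chart
  have hQ : HasStrictFDerivAt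
      (fun Φ : TDir d n (L * M') => twoLevelQ L M' (cavg L V) (chart (ContinuousLinearMap.id ℝ 𝕄) (L * M') (cavg L V) Φ))
      (twoLevelQ' L M' (cavg L V)) 0 := by
    have hcoord : HasStrictFDerivAt (coord (ContinuousLinearMap.id ℝ 𝕄) L M' (cavg L V))
        (fderiv ℝ (coord (ContinuousLinearMap.id ℝ 𝕄) L M' (cavg L V)) 0) 0 :=
      (contDiffAt_coord (m := 1) (ContinuousLinearMap.id ℝ 𝕄) L M' (cavg L V) hW₁).hasStrictFDerivAt one_ne_zero
    exact (skewPR (d := d) (n := n) M').hasStrictFDerivAt.comp 0 hcoord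
  -- its differential is onto `skewSub M'` (the periodic lift one level up)
  have hQ' : ∀ γ : ↥(skewSub d n M'), ∃ Φ : TDir d n (L * M'), (∀ r κ, Φ r κ ∈ skewAdjoint 𝕄) ∧
      twoLevelQ' L M' (cavg L V) Φ = γ := by
    intro γ
    have hγ : ∀ (r : Fin d → Fin M') (κ : Fin d), (γ : TDir d n M') r κ ∈ skewAdjoint 𝕄 := γ.2
    have hφP : ∀ (y : Site d) (j κ : Fin d), extDir M' (γ : TDir d n M') (y + (M' : ℤ) • e j) κ
        = extDir M' (γ : TDir d n M') y κ := fun y j κ => isPeriodicDir_extDir M' _ y j κ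
    obtain ⟨χ, -, hχP, hχpush, -, hχs⟩ :=
      exists_lift_periodic hL hV₁u hV₁P ha1 hliftA1 hV₁a (extDir M' (γ : TDir d n M')) hφP
    have hχskew : IsSkewDir χ := hχs fun y κ => hγ _ _
    have hχP' : IsPeriodicDir χ ((L * M' : ℕ) : ℤ) := by rw [natCast_mul_period]; exact hχP
    refine ⟨resDir (L * M') χ, fun r κ => hχskew _ _, ?_⟩
    apply Subtype.ext
    have hval : ((twoLevelQ' L M' (cavg L V) (resDir (L * M') χ) : ↥(skewSub d n M')) : TDir d n M')
        = skewPF M' ((fderiv ℝ (coord (ContinuousLinearMap.id ℝ 𝕄) L M' (cavg L V)) 0) (resDir (L * M') χ)) := rfl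
    rw [hval]
    have e : (fderiv ℝ (coord (ContinuousLinearMap.id ℝ 𝕄) L M' (cavg L V)) 0) (resDir (L * M') χ) = (γ : TDir d n M') := by
      funext r κ
      rw [fderiv_coord_apply (ContinuousLinearMap.id ℝ 𝕄) L M' (cavg L V) hW₁, chartDir_id_resDir (L * M') hχP', hχpush]
      simp only [extDir, redN_boxVec]
    rw [e]
    exact skewPF_of_mem γ.2
  -- the side condition: small-field `b` and second averages relatively within `1/4`
  set Near : (Site d → Fin d → 𝕄ˣ) → Prop := fun U => SmallField U b ∧ ∀ (r : Fin d → Fin M') (κ : Fin d),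
    ‖(((cavg L (cavg L V) (boxVec M' r) κ)⁻¹ : 𝕄ˣ) : 𝕄) * (cavg L (cavg L U) (boxVec M' r) κ : 𝕄) - 1‖ ≤ 1 / 4 with hNear
  have hVP' : IsPeriodicCfg V ((L * (L * M') : ℕ) : ℤ) := by rw [natCast_mul_period]; exact hVP
  have hNearE : ∀ᶠ θ in 𝓝 (0 : TDir d n (L * (L * M'))), Near (chart skewP (L * (L * M')) V θ) := by
    refine (eventually_smallField_chart skewP (L * (L * M')) hVP' hab hVa).and ?_
    refine Filter.eventually_all.mpr fun r => Filter.eventually_all.mpr fun κ => ?_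
    -- continuity of `θ ↦ V̿_b⁻¹ · cavg (cavg (chart θ)) b` through `cavg (chart θ) = chart_id (cavg L V) (coord θ)`
    have heq := eventually_cavg_chart_eq (M := L * M') hL hV hVP ha h512a hVa
    set q : Site d := (L : ℤ) • boxVec M' r with hq
    have hg : ContinuousAt (fun Φ : TDir d n (L * M') =>
        ((cavg L (chart (ContinuousLinearMap.id ℝ 𝕄) (L * M') (cavg L V) Φ) (boxVec M' r) κ : 𝕄ˣ) : 𝕄))
        (coord skewP L (L * M') V 0) := by
      rw [coord_zero]
      exact (contDiffAt_val_bavg_chart (m := 0) (ContinuousLinearMap.id ℝ 𝕄) (L * M') (cavg L V) L q κ 0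
        (by rw [chart_zero]; exact hW₁ q κ)).continuousAt
    have hf : ContinuousAt (coord skewP L (L * M') V) 0 :=
      (contDiffAt_coord (m := 0) skewP L (L * M') V (norm_Wcx_sub_one_lt_one_of_smallField L hL hV ha h512a hVa)).continuousAt
    have hcomp : ContinuousAt (fun θ : TDir d n (L * (L * M')) =>
        ‖(((cavg L (cavg L V) (boxVec M' r) κ)⁻¹ : 𝕄ˣ) : 𝕄)
          * ((cavg L (chart (ContinuousLinearMap.id ℝ 𝕄) (L * M') (cavg L V) (coord skewP L (L * M') V θ))
              (boxVec M' r) κ : 𝕄ˣ) : 𝕄) - 1‖) 0 :=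
      ((continuousAt_const.mul (ContinuousAt.comp (f := coord skewP L (L * M') V) hg hf)).sub continuousAt_const).norm
    have hc : ContinuousAt (fun θ : TDir d n (L * (L * M')) =>
        ‖(((cavg L (cavg L V) (boxVec M' r) κ)⁻¹ : 𝕄ˣ) : 𝕄)
          * ((cavg L (cavg L (chart skewP (L * (L * M')) V θ)) (boxVec M' r) κ : 𝕄ˣ) : 𝕄) - 1‖) 0 := by
      refine hcomp.congr_of_eventuallyEq (heq.mono fun θ hθ => ?_)
      simp only [hθ]
    have h0 : ‖(((cavg L (cavg L V) (boxVec M' r) κ)⁻¹ : 𝕄ˣ) : 𝕄)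
        * ((cavg L (cavg L (chart skewP (L * (L * M')) V 0)) (boxVec M' r) κ : 𝕄ˣ) : 𝕄) - 1‖ < 1 / 4 := by
      rw [chart_zero, Units.inv_mul, sub_self, norm_zero]
      norm_num
    exact (hc.eventually (gt_mem_nhds h0)).mono fun θ hθ => hθ.le
  -- the honest minimality gives the chart-constrained minimality under `Near`
  have hVP2 : IsPeriodicCfg (cavg L (cavg L V)) (M' : ℤ) := isPeriodicCfg_cavg L M' hV₁P
  have hVu2 : IsUnitaryCfg (cavg L (cavg L V)) := cavg_isUnitaryCfg hL hV₁u ha1 h512a1 hV₁a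
  have hmin' : ∀ U : Site d → Fin d → 𝕄ˣ, IsUnitaryCfg U → IsPeriodicCfg U ((L : ℤ) * (L * M' : ℕ)) → Near U →
      twoLevelQ L M' (cavg L V) (cavg L U) = twoLevelQ L M' (cavg L V) (cavg L V) →
        fineAction V (blockWindow L (periodBox (L * M'))).2 ≤ fineAction U (blockWindow L (periodBox (L * M'))).2 := by
    intro U hU hUP hUN hUQ
    obtain ⟨hUb, hUnear⟩ := hUN
    rw [twoLevelQ_self] at hUQ
    have hU₁u : IsUnitaryCfg (cavg L U) := cavg_isUnitaryCfg hL hU hb0 h512b hUb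
    have hU₁P : IsPeriodicCfg (cavg L U) ((L : ℤ) * M') := by
      have h := isPeriodicCfg_cavg L (L * M') hUP
      rw [natCast_mul_period] at h
      exact h
    have hU₁b : SmallField (cavg L U) (prop1Radius d L b) := smallField_cavg hL hU hb0 h512b hUb
    have hUu2 : IsUnitaryCfg (cavg L (cavg L U)) := cavg_isUnitaryCfg hL hU₁u hb1 h512b1 hU₁b
    have hUP2 : IsPeriodicCfg (cavg L (cavg L U)) (M' : ℤ) := isPeriodicCfg_cavg L M' hU₁P
    have heq : cavg L (cavg L U) = cavg L (cavg L V) :=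
      cavg_cavg_eq_of_twoLevelQ_eq hVP2 hUP2 hVu2 hUu2 hUnear hUQ
    exact hmin U hU hUP hUb heq
  exact fineCritical_of_isLocalMin (M := L * M') hV hVP ha hliftA hVa (twoLevelQ L M' (cavg L V)) (twoLevelQ' L M' (cavg L V)) hQ hQ'
    Near hNearE hmin'

/-- TANGENCY TO THE FIBRE OF THE SECOND AVERAGE IMPLIES THE ADMISSIBILITY PREDICATE: for an `L·M′`-periodic coarse
direction `φ` with `pushDir L (cavg L V) φ (L·z) = 0` for all `z` (B11's `T = ker D Q̄(W_k)`), `twoLevelQ'(res φ) = 0`.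
[cite: Balaban1985Variational, (83) p.290] -/
theorem twoLevelQ'_resDir_eq_zero [Nonempty n] {L M' : ℕ} [NeZero L] [NeZero M'] {V : Site d → Fin d → 𝕄ˣ}
    (hV : IsUnitaryCfg V) {a : ℝ} (ha : 0 ≤ a) (haS : twoLevelSmall d L * a ≤ 1) (hVa : SmallField V a)
    {φ : Site d → Fin d → 𝕄} (hφP : IsPeriodicDir φ ((L * M' : ℕ) : ℤ))
    (hφT : ∀ (z : Site d) (κ : Fin d), pushDir L (cavg L V) φ ((L : ℤ) • z) κ = 0) :
    twoLevelQ' L M' (cavg L V) (resDir (L * M') φ) = 0 := by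
  have hL : 1 ≤ L := Nat.one_le_iff_ne_zero.mpr (NeZero.ne L)
  obtain ⟨hliftA, ha1, -, hliftA1⟩ := smallness_of_twoLevelSmall (d := d) hL ha haS
  have h512a : 512 * (d + 1) * (d + 4) * (L : ℝ) ^ 2 * a ≤ 1 := small512_of_liftSmall hL ha hliftA
  have h512a1 : 512 * (d + 1) * (d + 4) * (L : ℝ) ^ 2 * prop1Radius d L a ≤ 1 := small512_of_liftSmall hL ha1 hliftA1
  have hV₁u : IsUnitaryCfg (cavg L V) := cavg_isUnitaryCfg hL hV ha h512a hVa
  have hV₁a : SmallField (cavg L V) (prop1Radius d L a) := smallField_cavg hL hV ha h512a hVa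
  have hW₁ : ∀ (q : Site d) (κ : Fin d) (r : Fin d → Fin L), ‖((Wcx L (cavg L V) q κ (boxVec L r) : 𝕄ˣ) : 𝕄) - 1‖ < 1 :=
    norm_Wcx_sub_one_lt_one_of_smallField L hL hV₁u ha1 h512a1 hV₁a
  apply Subtype.ext
  have hval : ((twoLevelQ' L M' (cavg L V) (resDir (L * M') φ) : ↥(skewSub d n M')) : TDir d n M')
      = skewPF M' ((fderiv ℝ (coord (ContinuousLinearMap.id ℝ 𝕄) L M' (cavg L V)) 0) (resDir (L * M') φ)) := rfl
  rw [hval, Submodule.coe_zero]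
  have e : (fderiv ℝ (coord (ContinuousLinearMap.id ℝ 𝕄) L M' (cavg L V)) 0) (resDir (L * M') φ) = 0 := by
    funext r κ
    rw [fderiv_coord_apply (ContinuousLinearMap.id ℝ 𝕄) L M' (cavg L V) hW₁, chartDir_id_resDir (L * M') hφP, hφT]
    rfl
  rw [e, map_zero]

/-- **R2ᴱ ON THE TORUS FOR HONEST TWO-LEVEL CONSTRAINED MINIMISERS** (the non-linear, non-abelian analogue of
`T4AveragingDeficitTwoLevel.coarseResidual_twoLevel`): for `V` as in `fineCritical_twoLevel` — `U(N)`-valued of period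
`L·(L·M′)`, `|V(∂p) − 1| ≤ a < b`, `twoLevelSmall d L·b ≤ 1`, minimising the fine Wilson action of the period among the
unitary periodic `U` with `|U(∂p) − 1| ≤ b` and the same second average — and for EVERY `L·M′`-periodic coarse `𝔲(N)`
direction `φ` tangent to the fibre of the second average (`pushDir L (cavg L V) φ (L·z) = 0`), every coarse field `Φ`
agreeing with `φ` at the block corners and every derivative `D_c` at `0` of `s ↦ A^L_{[0,L·M′)^d}(V̄ e^{sΦ})`:
`L^{d−4}|D_c| ≤ wallConst·[‖∇_VF‖_{ℓ²(period)}·dualC2·‖φ‖_{ℓ²} + a²·dualC1·‖φ‖_{ℓ¹}]`.  Dictionary: `V = U_{k+1}`,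
`V̄ = W_k`, `D_c = ⟨J(W_k), φ⟩`, `φ ∈ T` — the block average of the two-level constrained minimiser is an approximately
critical point of the coarse action under the one-level constraint, the error measured against tangent directions in the
dual `ℓ²`/`ℓ¹` norms. [cite: Balaban1985Variational, (26)–(27) p.282, §E (115)–(121) p.295] -/
theorem dualResidual_twoLevel [Nonempty n] {L M' : ℕ} [NeZero L] [NeZero M'] {V : Site d → Fin d → 𝕄ˣ}
    (hV : IsUnitaryCfg V) (hVP : IsPeriodicCfg V ((L : ℤ) * (L * M' : ℕ))) {a b : ℝ} (ha : 0 ≤ a) (hab : a < b)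
    (hb : twoLevelSmall d L * b ≤ 1) (hVa : SmallField V a)
    (hmin : ∀ U : Site d → Fin d → 𝕄ˣ, IsUnitaryCfg U → IsPeriodicCfg U ((L : ℤ) * (L * M' : ℕ)) → SmallField U b →
      cavg L (cavg L U) = cavg L (cavg L V) →
        fineAction V (blockWindow L (periodBox (L * M'))).2 ≤ fineAction U (blockWindow L (periodBox (L * M'))).2)
    (φ : Site d → Fin d → 𝕄) (hφs : ∀ (y : Site d) (κ : Fin d), φ y κ ∈ skewAdjoint 𝕄)
    (hφP : ∀ (y : Site d) (j κ : Fin d), φ (y + ((L * M' : ℕ) : ℤ) • e j) κ = φ y κ)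
    (hφT : ∀ (z : Site d) (κ : Fin d), pushDir L (cavg L V) φ ((L : ℤ) • z) κ = 0)
    (Φ : Site d → Fin d → 𝕄) (hΦ : ∀ (y : Site d) (κ : Fin d), Φ ((L : ℤ) • y) κ = φ y κ) {Dc : ℝ}
    (hDc : HasDerivAt (fun s : ℝ => coarseActionOf L (vary (bavg L V) Φ s) (blockWindow L (periodBox (L * M'))).1) Dc 0) :
    (L : ℝ) ^ ((d : ℤ) - 4) * |Dc|
      ≤ wallConst d L * (Real.sqrt (gradFluxSq V (blockSites L (periodBox (L * M'))))
            * (dualC2 d L * Real.sqrt (coarseSq (L * M') φ))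
          + a ^ 2 * (dualC1 d L * coarseL1 (L * M') φ)) := by
  have hL : 1 ≤ L := Nat.one_le_iff_ne_zero.mpr (NeZero.ne L)
  have hLM : 1 ≤ L * M' := Nat.one_le_iff_ne_zero.mpr (Nat.mul_ne_zero (NeZero.ne L) (NeZero.ne M'))
  have haS : twoLevelSmall d L * a ≤ 1 :=
    (mul_le_mul_of_nonneg_left hab.le (by unfold twoLevelSmall; positivity)).trans hb
  obtain ⟨hliftA, -, -, -⟩ := smallness_of_twoLevelSmall (d := d) hL ha haS
  have hcrit := fineCritical_twoLevel hV hVP ha hab hb hVa hmin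
  have hφT' : twoLevelQ' L M' (cavg L V) (resDir (L * M') fun y κ => φ y κ) = 0 :=
    twoLevelQ'_resDir_eq_zero hV ha haS hVa (fun y j κ => hφP y j κ) hφT
  exact dualResidual_torus hL hLM hV hVP ha hliftA hVa hcrit φ hφs hφP hφT' Φ hΦ hDc

end

end Summit.QuantumFields.BalabanUV.T4Continuum.AveragingDeficitTwoLevelFermat
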